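import Summits.ABC.ABC.Theses.DefiniteXi
import Literature.NumberTheory.EllipticCurves.DegreeConjectureAbcMurtyProofs
import HarnessLib

/-!
# Stub-ideation k2, generation 13 (HOME FAMILY 2 — RESHAPE) — `stub_primeToSixDegreeBound` (P6)
# crux `DefiniteXi.SteinbergCore` (stmt-ABC-15024), line `p6_tamagawa_split` (sha cda023e8)

Elaboration companion of `STUB-IDEAS-stub_primeToSixDegreeBound-2.md` (gen 13): STATEMENTS ONLY
(every helper lemma below is a `def … : Prop` naming the exact type a prover would prove; the two
`theorem`s are definitional sanity checks).  Gens 2–12 of this seat stand by reference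
(`STUB_IDEAS_stub_primeToSixDegreeBound_2_g2 … _g12*.lean`).

New Family-2 cell of gen 13 = the **probabilistic / counting reformulation** of P6 and its
**weaken-(to density)-and-bootstrap ladder** `P6OffSparse θ` (θ = exponent of the exceptional count
in a height box):

* `StubAt ε C a b` — the registered stub's inequality at ONE Frey pair; `Stub ↔ ∀ε>0 ∃C ∀(a,b), StubAt`
  (`Iff.rfl`).
* `P6OffSparse θ` — for every `ε > 0` some constant `C` has at most `K·X^θ` exceptional coprime pairs
  `(a,b) ∈ [-X,X]²`.  `Stub → P6OffSparse θ` for every `θ` (PROVED, trivial); `P6OffSparse 0 ↔ Stub`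
  (helper L5: bounded count in every box ⟹ finite exceptional set ⟹ enlarge `C`).
* L2 `RadicalDeficit` — an exception at `(ε, C)` is an abc triple of exponent `< 1`:
  `rad|ab(a+b)| < 2·max(|a|,|b|)^{1/(1+ε/2)}` (contrapositive of k2 g10's Z1a `deg D ≤ K c_D² N^{1+t} H`
  + Pasten's Frey–Manin bound + minimality + `rad ∣ 2N`).
* L3 — counting transfer: `N_l(X) ≤ K X^θ` for every `l < 1` (Bernert–Browning–Lichtman–Teräväinen 2024,
  arXiv:2410.12234 Thm 1.2: `θ = 33/50` for `l < 1.001`; Prop 1.1 = de Bruijn: `θ = 2l/3 + η`) ⟹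
  `P6OffSparse θ`.
So `P6OffSparse (33/50)` is a theorem modulo named true-in-print facts, `P6OffSparse 0` is the stub, and
no counting method upgrades a power-sparse exceptional set to a finite one: the bootstrap step IS abc|Frey.
-/

set_option linter.dupNamespace false

noncomputable section

namespace Summit.ABC.ABC.Cruxes.SteinbergCore.StubIdeas2G13

open scoped MatrixGroups Classical
open Literature.NumberTheory.EllipticCurves Literature.NumberTheory.EllipticCurves.ModularForms
open Literature.NumberTheory.DiophantineGeometry
open CongruenceSubgroup UniqueFactorizationMonoid
open Summit.ABC.ABC.Theses.DefiniteXi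

/-! ### The stub and its pointwise form -/

/-- The registered stub `stub_primeToSixDegreeBound` of `Lines/p6_tamagawa_split.lean`, verbatim
(= `StubIdeas2G10.Stub` = `StubIdeas3G14.Stub` = `StubIdeas1G2.P6`). [folklore] -/
def Stub : Prop :=
  ∀ ε : ℝ, 0 < ε → ∃ C : ℝ, ∀ a b : ℤ, IsCoprime a b → a * b * (a + b) ≠ 0 → ∀ (N : ℕ) [NeZero N],
    (Literature.NumberTheory.EllipticCurves.freyCurve a b).conductorNorm ℤ = N →
    ∀ D : Literature.NumberTheory.EllipticCurves.ModularForms.ModularParametrizationData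
      (Literature.NumberTheory.EllipticCurves.freyCurve a b) N,
      (∀ D' : Literature.NumberTheory.EllipticCurves.ModularForms.ModularParametrizationData
        (Literature.NumberTheory.EllipticCurves.freyCurve a b) N, D.deg ≤ D'.deg) →
      ((D.deg / (ordProj[2] D.deg * ordProj[3] D.deg) : ℕ) : ℝ) ≤ C * (N : ℝ) ^ (2 + ε)

/-- `StubAt ε C a b`: the stub's inequality at ONE Frey pair `(a,b)` with the constants `(ε, C)`
(all conductor witnesses `N`, all minimal-degree data `D`). [folklore] -/
def StubAt (ε C : ℝ) (a b : ℤ) : Prop :=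
  ∀ (N : ℕ) [NeZero N], (freyCurve a b).conductorNorm ℤ = N →
    ∀ D : ModularParametrizationData (freyCurve a b) N,
      (∀ D' : ModularParametrizationData (freyCurve a b) N, D.deg ≤ D'.deg) →
      ((D.deg / (ordProj[2] D.deg * ordProj[3] D.deg) : ℕ) : ℝ) ≤ C * (N : ℝ) ^ (2 + ε)

/-- The stub is `∀ ε > 0, ∃ C, ∀ coprime (a,b) with ab(a+b) ≠ 0, StubAt ε C a b` — definitionally.
[folklore] -/
theorem stub_iff_stubAt :
    Stub ↔ ∀ ε : ℝ, 0 < ε → ∃ C : ℝ, ∀ a b : ℤ, IsCoprime a b → a * b * (a + b) ≠ 0 → StubAt ε C a b :=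
  Iff.rfl

/-! ### The exceptional set and the sparse-exception ladder `P6OffSparse θ` -/

/-- The `(ε, C)`-exceptional set of P6: coprime pairs with `ab(a+b) ≠ 0` at which `StubAt ε C` fails.
[folklore] -/
def Exceptional (ε C : ℝ) : Set (ℤ × ℤ) :=
  {p | IsCoprime p.1 p.2 ∧ p.1 * p.2 * (p.1 + p.2) ≠ 0 ∧ ¬ StubAt ε C p.1 p.2}

/-- Number of `(ε, C)`-exceptional pairs in the height box `[-X, X]²`. [folklore] -/
def exceptionalCount (ε C : ℝ) (X : ℕ) : ℕ :=
  ((Finset.Icc (-(X : ℤ)) X ×ˢ Finset.Icc (-(X : ℤ)) X).filter fun p => p ∈ Exceptional ε C).card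

/-- **Sparse-exception form of P6 with exponent `θ`:** for every `ε > 0` some constant `C` admits at
most `K · X^θ` exceptional pairs of height `≤ X`, for every `X ≥ 1`. [folklore] -/
def P6OffSparse (θ : ℝ) : Prop :=
  ∀ ε : ℝ, 0 < ε → ∃ C K : ℝ, ∀ X : ℕ, 1 ≤ X → (exceptionalCount ε C X : ℝ) ≤ K * (X : ℝ) ^ θ

/-- The top of the ladder is free: the stub has NO exceptions, so it is `θ`-sparse for every `θ`
(`K = 0`).  PROVED (sanity). [folklore] -/
theorem offSparse_of_stub (h : Stub) (θ : ℝ) : P6OffSparse θ := by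
  intro ε hε
  obtain ⟨C, hC⟩ := h ε hε
  refine ⟨C, 0, fun X _ => ?_⟩
  have h0 : exceptionalCount ε C X = 0 := by
    unfold exceptionalCount
    rw [Finset.card_eq_zero, Finset.filter_eq_empty_iff]
    rintro ⟨a, b⟩ - ⟨hab, hne, hnot⟩
    exact hnot (hC a b hab hne)
  rw [h0, Nat.cast_zero, zero_mul]

/-! ### The counting side: abc triples of exponent `l` in a box (BBLT 2024 notation `N_l(X)`) -/

/-- `N_l(X)` = number of abc triples `(a, b, c) ∈ [1, X]³` (`a + b = c`, `gcd(a,b) = 1`) of exponent `l`,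
i.e. with `rad(abc) < c^l` (Bernert–Browning–Lichtman–Teräväinen 2024, §1). [cite: arXiv:2410.12234, §1] -/
def abcExponentCount (l : ℝ) (X : ℕ) : ℕ :=
  ((Finset.Icc 1 X ×ˢ Finset.Icc 1 X ×ˢ Finset.Icc 1 X).filter fun t : ℕ × ℕ × ℕ =>
      IsABCTriple t.1 t.2.1 t.2.2 ∧ ((rad t.1 t.2.1 t.2.2 : ℕ) : ℝ) < (t.2.2 : ℝ) ^ l).card

/-- Power bound `N_l(X) ≤ K · X^θ` for all `X ≥ 1`. [folklore] -/
def AbcExponentCount (l θ : ℝ) : Prop :=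
  ∃ K : ℝ, ∀ X : ℕ, 1 ≤ X → (abcExponentCount l X : ℝ) ≤ K * (X : ℝ) ^ θ

/-- **BBLT 2024, Theorem 1.2** (NOT in the tree; true in print): for fixed `l ∈ (0, 1.001)`,
`N_l(X) = O(X^{33/50})`. [cite: arXiv:2410.12234, Thm. 1.2] -/
def BBLT2024_thm_1_2 : Prop :=
  ∀ l : ℝ, 0 < l → l < 1.001 → AbcExponentCount l (33 / 50)

/-- **BBLT 2024, Proposition 1.1 = de Bruijn's "trivial bound"** (elementary; not in the tree):
`N_l(X) = O_η(X^{2l/3+η})`. [cite: arXiv:2410.12234, Prop. 1.1] -/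
def BBLT2024_prop_1_1 : Prop :=
  ∀ l : ℝ, 0 < l → ∀ η : ℝ, 0 < η → AbcExponentCount l (2 * l / 3 + η)

/-! ### Inputs of the pointwise transfer (all typed before; copied so that this file imports built modules only) -/

/-- **Z1a as a statement** (= `StubIdeas2G10.deg_le_maninSq_mul_height`, PROVED there from the Frey
Petersson upper bound, itself PROVED from modularity in `StubIdeas1G2`): Zagier's identity + Silverman's
covolume inequality give `deg φ_D ≤ K_t · c_D² · N^{1+t} · max(|a|,|b|)` for EVERY datum.
[cite: MurtyCongruencePrimes1999, §2] [cite: ZagierCMB1985, §1] -/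
def FreyDegHeightBound : Prop :=
  ∀ t : ℝ, 0 < t → ∃ K : ℝ, 0 ≤ K ∧ ∀ a b : ℤ, IsCoprime a b → a * b * (a + b) ≠ 0 →
    ∀ (N : ℕ) [NeZero N], (freyCurve a b).conductorNorm ℤ = N →
      ∀ D : ModularParametrizationData (freyCurve a b) N,
        (D.deg : ℝ) ≤ K * (D.maninConstant : ℝ) ^ 2 * (N : ℝ) ^ (1 + t) * max |(a : ℝ)| |(b : ℝ)|

/-- Uniformly bounded Manin constants on the Frey family (= `StubIdeas3G14.FreyManinBound`; PROVED there
from `PastenShimura2024_cor_10_2.exists_freyCurve_datum_maninConstant_le` modulo the named facts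
`PastenShimura2024_cor_10_2`, `exists_optimal_modularParametrizationData`,
`mazurKenku_exists_cyclic_isogeny`, `integral_neronScaling_of_isGloballyMinimal`).
[cite: PastenShimura2024, Cor. 10.2] -/
def FreyManinBound : Prop :=
  ∃ M : ℕ, ∀ a b : ℤ, IsCoprime a b → a * b * (a + b) ≠ 0 →
    ∀ (N : ℕ) [NeZero N], (freyCurve a b).conductorNorm ℤ = N →
      ∃ D : ModularParametrizationData (freyCurve a b) N, D.maninConstant.natAbs ≤ M

/-! ### Helper-lemma STATEMENTS of gen 13 (each the exact type to prove; sizes in the .md) -/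

/-- **RadicalDeficit** (conclusion of L2): for every `ε > 0` there is a constant `C` such that every
`(ε, C)`-exception is an abc triple of exponent `< 1`: `rad|ab(a+b)| < 2 · max(|a|,|b|)^{1/(1+ε/2)}`.
[folklore] -/
def RadicalDeficit : Prop :=
  ∀ ε : ℝ, 0 < ε → ∃ C : ℝ, ∀ a b : ℤ, IsCoprime a b → a * b * (a + b) ≠ 0 → ¬ StubAt ε C a b →
    ((radical (a * b * (a + b)).natAbs : ℕ) : ℝ) < 2 * (max |(a : ℝ)| |(b : ℝ)|) ^ (1 / (1 + ε / 2))

/-- **L2 (M):** Z1a + Manin bound + minimality + `rad ∣ 2N`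
(`radical_natAbs_dvd_two_mul_conductorNorm_freyCurve`) ⟹ `RadicalDeficit`, with `C := K_{ε/2}·M²`:
an exception forces `K M² N^{1+ε/2} H ≥ deg D₀ ≥ deg D ≥ cps(deg D) > K M² N^{2+ε}`, so `N < H^{1/(1+ε/2)}`
and `rad ≤ 2N`. [folklore] -/
def L2_radicalDeficit_of_heightBound : Prop :=
  FreyDegHeightBound → FreyManinBound → RadicalDeficit

/-- **L3 (M):** counting transfer.  If `N_l(X) ≤ K_l X^θ` for every `l ∈ (0,1)` and `RadicalDeficit`
holds, then `P6OffSparse θ`: sign-normalise an exceptional pair `(a,b) ∈ [-X,X]²` to a positive triple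
`x + y = z` with `z = max(|a|,|b|,|a+b|) ≤ 2X` (≤ 12 pairs per triple), note
`rad(xyz) < 2 z^{1/(1+ε/2)} < z^l` for `1/(1+ε/2) < l < 1` and `z ≥ z₀(ε,l)`, and absorb the finitely many
pairs with `z < z₀` into `K` (`X ≥ 1`, `θ ≥ 0`). [folklore] -/
def L3_offSparse_of_count : Prop :=
  ∀ θ : ℝ, 0 ≤ θ → (∀ l : ℝ, 0 < l → l < 1 → AbcExponentCount l θ) → RadicalDeficit → P6OffSparse θ

/-- **L5 (S/M):** the `θ = 0` end of the ladder IS the stub: a uniformly bounded count in every box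
makes the `(ε, C)`-exceptional set finite, and finitely many exceptions are absorbed by enlarging `C`
(all minimal data of one pair share one degree; cf. k2 g5 `stub_of_exceptionalFinite`, T9); the
converse is `offSparse_of_stub`. [folklore] -/
def L5_offSparse_zero_iff_stub : Prop :=
  P6OffSparse 0 ↔ Stub

/-- **Assembly of the rung (XS once L2, L3 land):** the density form of P6 at BBLT's exponent, modulo
named true-in-print inputs only. [cite: arXiv:2410.12234, Thm. 1.2] -/
def Rung_P6OffSparse_33_50 : Prop :=
  BBLT2024_thm_1_2 → FreyDegHeightBound → FreyManinBound → P6OffSparse (33 / 50)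

/-- The rung's assembly term, PROVED from the three helper statements (pure logic). [folklore] -/
theorem rung_of_helpers (hL2 : L2_radicalDeficit_of_heightBound) (hL3 : L3_offSparse_of_count) :
    Rung_P6OffSparse_33_50 := by
  intro hB hZ hM
  refine hL3 (33 / 50) (by norm_num) (fun l hl0 hl1 => hB l hl0 (by linarith)) (hL2 hZ hM)

end Summit.ABC.ABC.Cruxes.SteinbergCore.StubIdeas2G13

end
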